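import Summits.Ventures.LatticeQCDFlow.Exactness.ReversibleStickySet
import Summits.Ventures.LatticeQCDFlow.Exactness.Phi4HMCTailRejection
import HarnessLib

/-!
# Tail rejection kills the spectral gap for EVERY HMC-type update of lattice φ⁴ (any integrator `Ψ`)

HONEST FRAMING: exact (Metropolis-corrected) sampling algorithms for lattice gauge theory;
figures of merit are autocorrelation/cost numbers at stated couplings and volumes; no
continuum-physics claim.  (SCALAR calibration rung S0-A: not a gauge result.)

Venture `LatticeQCDFlow` (cell pub-lqcd), topic `Exactness`; FANOUT row 2 (`s0-phi4`, HMC arm).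
NEW WORK of the cell, composing the abstract sticky-set criterion `RevOp.autocorr_ge_of_sticky`
(`Exactness/ReversibleStickySet.lean`) with row 2's HMC-type update `hmcOpOf J λ Ψ`
(`Exactness/Phi4HMCExact.lean`, `Phi4HMCCarreDuChamp.lean`: a reversible Markov operator on bounded
observables for EVERY measurable Lebesgue-preserving involution `Ψ` of phase space) and the far-box
lemmas of `Exactness/Phi4HMCTailRejection.lean`.  Nothing is cited as a fact (Roberts–Tweedie 1996
named in the abstract file).

## What is proved (`Λ = Fin (n+1)`, `λ > 0`, real `J`; `Ψ` measurable, involutive, Lebesgue-preserving;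
`a(φ,p) = min(1, e^{H(φ,p) − H(Ψ(φ,p))})`, `A_t = {t ≤ φ_x ≤ 2t ∀x}`, `χ_t` its indicator, `g_t = χ_t − ⟨χ_t⟩`)

* `integrable_involAccept_mul_momentumWeight'`, `hmcOpOf_one_sub_le_accept'` — for a `0/1`-valued
  `χ` and `χ(φ) = 1`: `K_Ψ[1 − χ](φ) ≤ Z_p⁻¹ ∫ a(φ,p) e^{−½Σp²} dp` (leaving needs accepting);
* `involAccept_le_of_gap'`, **`accept_le_of_gap'`** — an energy gap `≥ L` on the momenta
  `|p_y| ≤ t/δ` gives `Z_p⁻¹ ∫ a(φ,p) e^{−½Σp²} dp ≤ e^{−L} + V(δ/t)²` (Chebyshev beyond);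
* `integral_boxInd_le_exp` — how small the sticky box is: `∫ χ_t e^{−S} ≤ t^V e^{K₀ − Vt²}`;
* **`hmcOpOf_no_spectral_gap_of_box_rejection`** — if for every `ε > 0` the update is accepted with
  probability `≤ ε` from every configuration of the far box `A_t`, eventually in `t`, then for every
  `ε > 0` there is `t ≥ 1` with `∫ g_t² e^{−S} > 0` and `ρ_{g_t}(1) ≥ 1 − ε`: NO SPECTRAL GAP.

Instances: qpq every `N` (`Phi4HMCNoSpectralGapN`, proved directly), pqp (`Phi4HMCPQPNoSpectralGap`).
NOT CLAIMED: the tail-rejection hypothesis for any particular `Ψ` (separate files).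
-/

namespace Summit.Ventures.LatticeQCDFlow.Exactness

open Real MeasureTheory Filter Finset
open Summit.Ventures.LatticeQCDFlow.Scoring

section StickyBox

variable {n : ℕ}

/-- The acceptance integrand `p ↦ a(φ, p) e^{−½Σp²}` is integrable for every measurable `Ψ`. -/
theorem integrable_involAccept_mul_momentumWeight' (J : Fin (n + 1) → Fin (n + 1) → ℝ) (lam : ℝ)
    {Ψ : (Fin (n + 1) → ℝ) × (Fin (n + 1) → ℝ) → (Fin (n + 1) → ℝ) × (Fin (n + 1) → ℝ)}
    (hΨm : Measurable Ψ) (φ : Fin (n + 1) → ℝ) :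
    Integrable (fun p : Fin (n + 1) → ℝ =>
      involAccept (phi4HmcEnergy J lam) Ψ (φ, p) * momentumWeight p) := by
  have hH := measurable_phi4HmcEnergy J lam (n := n)
  have hpair : Measurable fun p : Fin (n + 1) → ℝ => (φ, p) := measurable_const.prodMk measurable_id
  have ha : Measurable fun p : Fin (n + 1) → ℝ => involAccept (phi4HmcEnergy J lam) Ψ (φ, p) := by
    unfold involAccept
    exact measurable_const.min (Real.measurable_exp.comp
      ((hH.comp hpair).sub (hH.comp (hΨm.comp hpair))))
  refine Integrable.mono' integrable_momentumWeight
    (ha.mul measurable_momentumWeight).aestronglyMeasurable (Eventually.of_forall fun p => ?_)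
  have hw0 : 0 ≤ momentumWeight p := (Real.exp_pos _).le
  rw [Real.norm_eq_abs, abs_mul, abs_of_nonneg (involAccept_nonneg _ _ _), abs_of_nonneg hw0]
  exact mul_le_of_le_one_left hw0 (involAccept_le_one _ _ _)

/-- From a configuration with `χ = 1` the observable `1 − χ` is moved to at most the acceptance
probability: `K_Ψ[1 − χ](φ) ≤ Z_p⁻¹ ∫ a(φ,p) e^{−½Σp²} dp` (every measurable `Ψ`). -/
theorem hmcOpOf_one_sub_le_accept' (J : Fin (n + 1) → Fin (n + 1) → ℝ) (lam : ℝ)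
    {Ψ : (Fin (n + 1) → ℝ) × (Fin (n + 1) → ℝ) → (Fin (n + 1) → ℝ) × (Fin (n + 1) → ℝ)}
    (hΨm : Measurable Ψ) {χ : (Fin (n + 1) → ℝ) → ℝ} (h01 : ∀ φ, χ φ = 0 ∨ χ φ = 1)
    {φ : Fin (n + 1) → ℝ} (hφ : χ φ = 1) :
    hmcOpOf J lam Ψ (fun ψ => 1 - χ ψ) φ
      ≤ (∫ p, involAccept (phi4HmcEnergy J lam) Ψ (φ, p) * momentumWeight p) / momentumZ n := by
  have hZp := momentumZ_pos n
  unfold hmcOpOf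
  refine div_le_div_of_nonneg_right ?_ hZp.le
  refine integral_mono_of_nonneg (Eventually.of_forall fun p => ?_)
    (integrable_involAccept_mul_momentumWeight' J lam hΨm φ) (Eventually.of_forall fun p => ?_)
  · have ha0 := involAccept_nonneg (phi4HmcEnergy J lam) Ψ (φ, p)
    have ha1 := involAccept_le_one (phi4HmcEnergy J lam) Ψ (φ, p)
    have hw0 : 0 ≤ momentumWeight p := (Real.exp_pos _).le
    show (0 : ℝ) ≤ (involAccept (phi4HmcEnergy J lam) Ψ (φ, p) * (1 - χ (Ψ (φ, p)).1)
        + (1 - involAccept (phi4HmcEnergy J lam) Ψ (φ, p)) * (1 - χ φ)) * momentumWeight p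
    rw [hφ]
    rcases h01 (Ψ (φ, p)).1 with h | h <;>
      · rw [h]; nlinarith
  · have ha0 := involAccept_nonneg (phi4HmcEnergy J lam) Ψ (φ, p)
    have hw0 : 0 ≤ momentumWeight p := (Real.exp_pos _).le
    show (involAccept (phi4HmcEnergy J lam) Ψ (φ, p) * (1 - χ (Ψ (φ, p)).1)
        + (1 - involAccept (phi4HmcEnergy J lam) Ψ (φ, p)) * (1 - χ φ)) * momentumWeight p
      ≤ involAccept (phi4HmcEnergy J lam) Ψ (φ, p) * momentumWeight p
    rw [hφ, sub_self, mul_zero, add_zero]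
    refine mul_le_mul_of_nonneg_right ?_ hw0
    rcases h01 (Ψ (φ, p)).1 with h | h
    · rw [h, sub_zero, mul_one]
    · rw [h, sub_self, mul_zero]; exact ha0

/-- **Pointwise acceptance bound from a gap** (every `Ψ`): a gap `≥ L` for the momenta with
`|p_y| ≤ t/δ` (`δ, t > 0`) gives `a(φ, p) ≤ e^{−L} + (δ/t)² Σ_x p_x²` for EVERY `p`. -/
theorem involAccept_le_of_gap' {lam δ t L : ℝ} (hδ : 0 < δ) (ht : 0 < t)
    (J : Fin (n + 1) → Fin (n + 1) → ℝ)
    (Ψ : (Fin (n + 1) → ℝ) × (Fin (n + 1) → ℝ) → (Fin (n + 1) → ℝ) × (Fin (n + 1) → ℝ))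
    {φ : Fin (n + 1) → ℝ}
    (hgap : ∀ p : Fin (n + 1) → ℝ, (∀ y, |p y| ≤ t / δ) →
      L ≤ phi4HmcEnergy J lam (Ψ (φ, p)) - phi4HmcEnergy J lam (φ, p)) (p : Fin (n + 1) → ℝ) :
    involAccept (phi4HmcEnergy J lam) Ψ (φ, p) ≤ Real.exp (-L) + (δ / t) ^ 2 * ∑ x, p x ^ 2 := by
  have hsum0 : 0 ≤ (δ / t) ^ 2 * ∑ x, p x ^ 2 :=
    mul_nonneg (sq_nonneg _) (Finset.sum_nonneg fun x _ => sq_nonneg _)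
  by_cases hG : ∀ y, |p y| ≤ t / δ
  · have hΔ := hgap p hG
    unfold involAccept
    calc min 1 (Real.exp (phi4HmcEnergy J lam (φ, p) - phi4HmcEnergy J lam (Ψ (φ, p))))
        ≤ Real.exp (phi4HmcEnergy J lam (φ, p) - phi4HmcEnergy J lam (Ψ (φ, p))) := min_le_right _ _
      _ ≤ Real.exp (-L) := Real.exp_le_exp.mpr (by linarith)
      _ ≤ Real.exp (-L) + (δ / t) ^ 2 * ∑ x, p x ^ 2 := le_add_of_nonneg_right hsum0
  · push Not at hG
    obtain ⟨y, hy⟩ := hG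
    have h1 : (1 : ℝ) ≤ (δ / t) ^ 2 * ∑ x, p x ^ 2 := by
      have hy2 : (t / δ) ^ 2 < p y ^ 2 := by
        rw [← sq_abs (p y)]
        exact pow_lt_pow_left₀ hy (by positivity) two_ne_zero
      have hle : p y ^ 2 ≤ ∑ x, p x ^ 2 :=
        Finset.single_le_sum (f := fun x => p x ^ 2) (fun x _ => sq_nonneg _) (Finset.mem_univ y)
      have e : (δ / t) ^ 2 * (t / δ) ^ 2 = 1 := by field_simp
      have hδt : 0 < (δ / t) ^ 2 := by positivity
      nlinarith
    calc involAccept (phi4HmcEnergy J lam) Ψ (φ, p) ≤ 1 := involAccept_le_one _ _ _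
      _ ≤ (δ / t) ^ 2 * ∑ x, p x ^ 2 := h1
      _ ≤ Real.exp (-L) + (δ / t) ^ 2 * ∑ x, p x ^ 2 := le_add_of_nonneg_left (Real.exp_pos _).le

/-- **Averaged acceptance bound from a gap** (every measurable `Ψ`):
`Z_p⁻¹ ∫ a(φ, p) e^{−½Σp²} dp ≤ e^{−L} + V(δ/t)²`. -/
theorem accept_le_of_gap' {lam δ t L : ℝ} (hδ : 0 < δ) (ht : 0 < t)
    (J : Fin (n + 1) → Fin (n + 1) → ℝ)
    (Ψ : (Fin (n + 1) → ℝ) × (Fin (n + 1) → ℝ) → (Fin (n + 1) → ℝ) × (Fin (n + 1) → ℝ))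
    {φ : Fin (n + 1) → ℝ}
    (hgap : ∀ p : Fin (n + 1) → ℝ, (∀ y, |p y| ≤ t / δ) →
      L ≤ phi4HmcEnergy J lam (Ψ (φ, p)) - phi4HmcEnergy J lam (φ, p)) :
    (∫ p, involAccept (phi4HmcEnergy J lam) Ψ (φ, p) * momentumWeight p) / momentumZ n
      ≤ Real.exp (-L) + ((n : ℝ) + 1) * (δ / t) ^ 2 := by
  have hZp := momentumZ_pos n
  rw [div_le_iff₀ hZp]
  have hpt := involAccept_le_of_gap' hδ ht J Ψ hgap
  have e : ∀ p : Fin (n + 1) → ℝ, (Real.exp (-L) + (δ / t) ^ 2 * ∑ x, p x ^ 2) * momentumWeight p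
      = Real.exp (-L) * momentumWeight p + (δ / t) ^ 2 * ∑ x, p x ^ 2 * momentumWeight p := by
    intro p
    rw [add_mul, mul_assoc, Finset.sum_mul]
  have hI1 : Integrable (fun p : Fin (n + 1) → ℝ =>
      (Real.exp (-L) + (δ / t) ^ 2 * ∑ x, p x ^ 2) * momentumWeight p) := by
    simp_rw [e]
    exact (integrable_momentumWeight.const_mul _).add
      ((integrable_finsetSum _ fun x _ => integrable_sq_mul_momentumWeight x).const_mul _)
  calc ∫ p, involAccept (phi4HmcEnergy J lam) Ψ (φ, p) * momentumWeight p
      ≤ ∫ p : Fin (n + 1) → ℝ, (Real.exp (-L) + (δ / t) ^ 2 * ∑ x, p x ^ 2) * momentumWeight p := by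
        refine integral_mono_of_nonneg (Eventually.of_forall fun p =>
          mul_nonneg (involAccept_nonneg _ _ _) (Real.exp_pos _).le) hI1
          (Eventually.of_forall fun p => ?_)
        exact mul_le_mul_of_nonneg_right (hpt p) (Real.exp_pos _).le
    _ = Real.exp (-L) * momentumZ n + (δ / t) ^ 2 * (((n : ℝ) + 1) * momentumZ n) := by
        simp_rw [e]
        rw [integral_add (integrable_momentumWeight.const_mul _)
          ((integrable_finsetSum _ fun x _ => integrable_sq_mul_momentumWeight x).const_mul _),
          integral_const_mul, integral_const_mul,
          integral_finsetSum _ fun x _ => integrable_sq_mul_momentumWeight x]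
        simp_rw [integral_sq_mul_momentumWeight]
        rw [Finset.sum_const, Finset.card_univ, Fintype.card_fin, nsmul_eq_mul]
        unfold momentumZ
        push_cast
        ring
    _ = (Real.exp (-L) + ((n : ℝ) + 1) * (δ / t) ^ 2) * momentumZ n := by ring

/-- **How small the sticky box is**: `∫ χ_t e^{−S} ≤ t^V · e^{K₀ − V t²}` (`t > 0`,
`K₀ = V(C_J + 1)²/(4λ)` the coercivity constant) — the obstruction to a spectral gap lives in a set of
Gibbs mass `≤ t^V e^{K₀ − Vt²}/Z`, astronomically small at any simulated parameters. -/
theorem integral_boxInd_le_exp {lam : ℝ} (hlam : 0 < lam) (J : Fin (n + 1) → Fin (n + 1) → ℝ)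
    {t : ℝ} (ht : 0 < t) :
    ∫ φ : Fin (n + 1) → ℝ, (if (∀ x, t ≤ φ x ∧ φ x ≤ 2 * t) then (1 : ℝ) else 0) * gibbsWeight J lam φ
      ≤ t ^ (n + 1) * Real.exp (((n : ℝ) + 1) * (((∑ x, ∑ y, |J x y|) + 1) ^ 2 / (4 * lam))
          - ((n : ℝ) + 1) * t ^ 2) := by
  set K₀ : ℝ := ((n : ℝ) + 1) * (((∑ x, ∑ y, |J x y|) + 1) ^ 2 / (4 * lam)) with hK₀
  set c : ℝ := Real.exp (K₀ - ((n : ℝ) + 1) * t ^ 2) with hc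
  have hco := latticePhi4Action_coercive hlam J
  -- pointwise: on the box `e^{−S} ≤ c`, off the box the integrand vanishes
  have hpt : ∀ φ : Fin (n + 1) → ℝ,
      (if (∀ x, t ≤ φ x ∧ φ x ≤ 2 * t) then (1 : ℝ) else 0) * gibbsWeight J lam φ
        ≤ Set.indicator (Set.Icc (fun _ => t) (fun _ => 2 * t)) (fun _ => c) φ := by
    intro φ
    by_cases hφ : ∀ x, t ≤ φ x ∧ φ x ≤ 2 * t
    · have hmem : φ ∈ Set.Icc (fun _ : Fin (n + 1) => t) (fun _ => 2 * t) := by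
        rw [← box_eq_Icc]; exact hφ
      rw [if_pos hφ, one_mul, Set.indicator_of_mem hmem]
      have hsq : ((n : ℝ) + 1) * t ^ 2 ≤ ∑ w, φ w ^ 2 := by
        have hx : ∀ x, t ^ 2 ≤ φ x ^ 2 := fun x => pow_le_pow_left₀ ht.le (hφ x).1 2
        calc ((n : ℝ) + 1) * t ^ 2 = ∑ _x : Fin (n + 1), t ^ 2 := by
              rw [Finset.sum_const, Finset.card_univ, Fintype.card_fin, nsmul_eq_mul]; push_cast; ring
          _ ≤ ∑ w, φ w ^ 2 := Finset.sum_le_sum fun x _ => hx x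
      have hS := hco φ
      unfold gibbsWeight
      rw [hc]
      refine Real.exp_le_exp.mpr ?_
      linarith
    · have hnot : φ ∉ Set.Icc (fun _ : Fin (n + 1) => t) (fun _ => 2 * t) := by
        rw [← box_eq_Icc]; exact hφ
      rw [if_neg hφ, zero_mul, Set.indicator_of_notMem hnot]
  have hvol : (volume (Set.Icc (fun _ : Fin (n + 1) => t) (fun _ => 2 * t))).toReal = t ^ (n + 1) := by
    rw [Real.volume_Icc_pi_toReal (fun _ => by linarith)]
    simp only [Finset.prod_const, Finset.card_univ, Fintype.card_fin]
    congr 1; ring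
  calc ∫ φ : Fin (n + 1) → ℝ, (if (∀ x, t ≤ φ x ∧ φ x ≤ 2 * t) then (1 : ℝ) else 0) * gibbsWeight J lam φ
      ≤ ∫ φ : Fin (n + 1) → ℝ, Set.indicator (Set.Icc (fun _ => t) (fun _ => 2 * t)) (fun _ => c) φ := by
        refine integral_mono_of_nonneg (Eventually.of_forall fun φ =>
          mul_nonneg (by split_ifs <;> norm_num) (gibbsWeight_pos J lam φ).le) ?_
          (Eventually.of_forall hpt)
        exact (continuousOn_const.integrableOn_compact isCompact_Icc).integrable_indicator measurableSet_Icc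
    _ = t ^ (n + 1) * c := by
        rw [integral_indicator_const c measurableSet_Icc, smul_eq_mul, measureReal_def, hvol]

/-- **TAIL REJECTION FROM FAR BOXES KILLS THE SPECTRAL GAP — every HMC-type update.**  `λ > 0`, real
`J`, `Ψ` a measurable Lebesgue-preserving involution of phase space, `K = hmcOpOf J λ Ψ`.  If for every
`ε > 0` there is `T ≥ 1` such that for all `t ≥ T` the update is accepted with probability at most `ε`
from every configuration of the box `A_t`, then for every `ε > 0` there is `t ≥ 1` such that
`g = χ_t − ⟨χ_t⟩` satisfies `∫ g² e^{−S} > 0` and `ρ_g(1) = ∫ g (K g) e^{−S} / ∫ g² e^{−S} ≥ 1 − ε`. -/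
theorem hmcOpOf_no_spectral_gap_of_box_rejection {lam : ℝ} (hlam : 0 < lam)
    (J : Fin (n + 1) → Fin (n + 1) → ℝ)
    {Ψ : (Fin (n + 1) → ℝ) × (Fin (n + 1) → ℝ) → (Fin (n + 1) → ℝ) × (Fin (n + 1) → ℝ)}
    (hΨm : Measurable Ψ) (hΨi : Function.Involutive Ψ)
    (hΨμ : MeasurePreserving Ψ ((volume : Measure (Fin (n + 1) → ℝ)).prod volume)
      ((volume : Measure (Fin (n + 1) → ℝ)).prod volume))
    (hrej : ∀ ε : ℝ, 0 < ε → ∃ T : ℝ, 1 ≤ T ∧ ∀ t : ℝ, T ≤ t → ∀ φ : Fin (n + 1) → ℝ,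
      (∀ y, t ≤ φ y ∧ φ y ≤ 2 * t) →
      (∫ p, involAccept (phi4HmcEnergy J lam) Ψ (φ, p) * momentumWeight p) / momentumZ n ≤ ε)
    {ε : ℝ} (hε : 0 < ε) :
    ∃ t : ℝ, 1 ≤ t ∧
      0 < ∫ φ, ((if (∀ x, t ≤ φ x ∧ φ x ≤ 2 * t) then (1 : ℝ) else 0)
          - gibbsExpect J lam (fun ψ => if (∀ x, t ≤ ψ x ∧ ψ x ≤ 2 * t) then (1 : ℝ) else 0)) ^ 2
          * gibbsWeight J lam φ ∧
      1 - ε ≤ (∫ φ, ((if (∀ x, t ≤ φ x ∧ φ x ≤ 2 * t) then (1 : ℝ) else 0)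
          - gibbsExpect J lam (fun ψ => if (∀ x, t ≤ ψ x ∧ ψ x ≤ 2 * t) then (1 : ℝ) else 0))
        * hmcOpOf J lam Ψ (fun ψ => (if (∀ x, t ≤ ψ x ∧ ψ x ≤ 2 * t) then (1 : ℝ) else 0)
          - gibbsExpect J lam (fun ψ => if (∀ x, t ≤ ψ x ∧ ψ x ≤ 2 * t) then (1 : ℝ) else 0)) φ
        * gibbsWeight J lam φ)
        / ∫ φ, ((if (∀ x, t ≤ φ x ∧ φ x ≤ 2 * t) then (1 : ℝ) else 0)
          - gibbsExpect J lam (fun ψ => if (∀ x, t ≤ ψ x ∧ ψ x ≤ 2 * t) then (1 : ℝ) else 0)) ^ 2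
          * gibbsWeight J lam φ := by
  have hco := latticePhi4Action_coercive hlam J
  have hZ := gibbsZ_pos hlam J
  set M₂ := ∫ φ : Fin (n + 1) → ℝ, φ 0 ^ 2 * gibbsWeight J lam φ with hM₂
  have hM₂0 : 0 ≤ M₂ := integral_nonneg fun φ => mul_nonneg (sq_nonneg _) (gibbsWeight_pos J lam φ).le
  obtain ⟨T, hT, hall⟩ := hrej (ε / 2) (half_pos hε)
  set t : ℝ := max T (1 + 2 * M₂ / gibbsZ J lam) with htdef
  have htT : 1 + 2 * M₂ / gibbsZ J lam ≤ t := le_max_right _ _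
  have ht1 : 1 ≤ t := le_trans hT (le_max_left _ _)
  have ht0 : 0 < t := by linarith
  refine ⟨t, ht1, ?_⟩
  set χ : (Fin (n + 1) → ℝ) → ℝ := fun φ => if (∀ x, t ≤ φ x ∧ φ x ≤ 2 * t) then (1 : ℝ) else 0
    with hχdef
  have hχ : BddObs χ := boxInd_bddObs t
  have h01 : ∀ φ, χ φ = 0 ∨ χ φ = 1 := fun φ => by
    rw [hχdef]; dsimp only; split_ifs
    · exact Or.inr rfl
    · exact Or.inl rfl
  set a := gibbsExpect J lam χ with ha
  set I := ∫ φ, χ φ * gibbsWeight J lam φ with hI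
  have hIpos : 0 < I := integral_boxInd_pos hlam J ht0
  have hIle : I ≤ 1 / t ^ 2 * M₂ := integral_boxInd_le hlam J ht0
  have haZ : a * ∫ φ, gibbsWeight J lam φ = I := by
    rw [ha, hI]; unfold gibbsExpect gibbsZ; exact div_mul_cancel₀ _ (by unfold gibbsZ at hZ; exact hZ.ne')
  have haI : a * gibbsZ J lam = I := by unfold gibbsZ; exact haZ
  have hahalf : a ≤ 1 / 2 := by
    have ht2 : 2 * M₂ / gibbsZ J lam ≤ t ^ 2 := by nlinarith
    have h1 : 2 * M₂ ≤ t ^ 2 * gibbsZ J lam := by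
      rw [div_le_iff₀ hZ] at ht2; linarith
    have h2 : I * t ^ 2 ≤ M₂ := by
      have := hIle
      rw [one_div, ← div_eq_inv_mul, le_div_iff₀ (by positivity)] at this
      linarith
    have h3 : a * gibbsZ J lam * t ^ 2 ≤ M₂ := by rw [haI]; exact h2
    have ht2pos : 0 < t ^ 2 := by positivity
    have ha0 : 0 < a := by rw [ha]; unfold gibbsExpect; exact div_pos hIpos hZ
    nlinarith [mul_pos hZ ht2pos]
  -- the box is sticky: `K[1 − χ] ≤ ε/2` on `{χ = 1}`
  have hsticky : ∀ φ, χ φ = 1 → hmcOpOf J lam Ψ (fun ψ => 1 - χ ψ) φ ≤ ε / 2 := by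
    intro φ hφ
    refine (hmcOpOf_one_sub_le_accept' J lam hΨm h01 hφ).trans (hall t (le_max_left _ _) φ ?_)
    by_contra hnot
    have : χ φ = 0 := by rw [hχdef]; dsimp only; rw [if_neg hnot]
    rw [this] at hφ
    exact zero_ne_one hφ
  have hρ := RevOp.autocorr_ge_of_sticky (μ := volume) (A := BddObs) (K := hmcOpOf J lam Ψ)
    (w := gibbsWeight J lam) (fun φ => (gibbsWeight_pos J lam φ).le) (bddObs_const 1)
    (fun f h hf hh => bddObs_integrable_mul_mul_gibbsWeight one_pos hco hf hh)
    (fun f h c hf hh => bddObs_add_mul hf hh c)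
    (fun f hf => bddObs_hmcOpOf J lam hΨm hf)
    (fun f h c hf hh x => hmcOpOf_add_mul_bddObs J lam hΨm hf hh c x)
    (fun f h hf hh => hmcOpOf_reversible_bddObs one_pos hco hΨm hΨi hΨμ hf hh)
    (fun φ => hmcOpOf_one J lam Ψ φ) hχ h01 (half_pos hε).le hsticky haZ hIpos hahalf
  have hP := RevOp.indicator_var_eq (μ := volume) (A := BddObs) (w := gibbsWeight J lam)
    (bddObs_const 1) (fun f h hf hh => bddObs_integrable_mul_mul_gibbsWeight one_pos hco hf hh)
    hχ h01 haZ
  have hPpos : 0 < (1 - a) * I := mul_pos (by linarith) hIpos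
  refine ⟨by rw [hP]; exact hPpos, ?_⟩
  have e : 1 - 2 * (ε / 2) = 1 - ε := by ring
  rw [e] at hρ
  exact hρ

end StickyBox

end Summit.Ventures.LatticeQCDFlow.Exactness
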